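import Literature.MathematicalPhysics.QuantumFieldTheory.Balaban1983to89.B8LeafModelV1
import Literature.MathematicalPhysics.QuantumFieldTheory.Balaban1983to89.B8Thm8Surviving
import Literature.MathematicalPhysics.QuantumFieldTheory.Balaban1983to89.B8Thm8MultiLevelTorus

/-!
# `Balaban1983to89.B8LeafModelV1Thm8` — T. Bałaban, *Spaces of regular gauge field configurations on a lattice and gauge fixing
# conditions*, Commun. Math. Phys. **99** (1985) 75–102 [Balaban1985RegularSpaces] = cell paper B8, DAG node **N05**, Sect. H
# **Theorem 8** p. 101: the leaf conjunct `t8` IN ITS SURVIVING FORM `B8Thm8Surviving.Thm8SurvivingAt γ B₁ B₂` (GAPS G-B8-13)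
# PROVED on the `k`-level V1 torus family at `U₀ = 1` (`B8LeafModelV1.v1GF`) — for EVERY γ ≥ 0, with `B₁` affine in γ

statement-level skeleton of published theorems with citation tags; proofs where landed; nothing here is a claim about the Yang–Mills mass gap

CITATION HEADER (lean-in-tree rule).  Cell `pub-ymgap` (YM-PLAN Track A, HUMAN RULING D-0062), seat `pub-ymgap-dag-n05-a` (KNIT-BY-NAME seat
of node N05; knit of record `B8LeafKnit` p408782).  PDF held: `paper:balaban1985-cmp99-regular-spaces-gauge-fixing` (journal page = PDF page
+ 74); p. 101 [PDF 27] is quoted verbatim in `B8SectGH`, `B8Thm8Surviving`, `B8Thm8MultiLevelTorus`; this file re-quotes only the clauses it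
reads.  Companion of `B8LeafModelV1` (same seat: the leaf's `t2 p3 t4` and the six carrier laws on the same family) and of
`B8Thm8Surviving` (the typed surviving form).

WHAT IS PRINTED (p. 101, verbatim).  *"… it is enough to assume that |f|₍₋₂₎ < γ(α₀ + α₁) with a positive, not too big, constant γ, e.g.
γ = 1. Inspecting the proofs of the theorems and propositions we can see easily that they work in this more general situation almost
without any changes, only some constants change their numerical values. … **Theorem 8.** There exist constants B₁, B₂(β₀), c₁ such that
for arbitrary U₀, U′U₀ satisfying (1.33)–(1.35) with α₀ + α₁ ≦ c₁, and for an arbitrary function f from the space R(U₀) satisfying the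
bound |f|₍₋₂₎ < γ(α₀ + α₁), there exists exactly one gauge transformation u satisfying (1.29) and such, that the conditions (1.36), (1.37),
(1.39), and (1.146) hold for the configuration U₁ = U′^{u⁻¹}. The constants B₁, B₂(β₀) are as in Theorems 2, 4, the constant c₁ depends
on d, L and γ."*

WHY.  Conjunct `t8 := B8SectGH.Thm8PrintedAt 1 B₁ B₂ fam` of the leaf `DagBinding.B8LeafR` is KERNEL-REFUTED on print's admitted flat abelian
instances (`B8Thm8FlatAbelianFamily.not_thm8PrintedAt`, `B8LeafKnit.not_b8LeafR_of_flat_subfamily`; G-B8-13: the `∇`- and Hölder members of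
(1.36) fail `k`-uniformly for `|f|₍₋₂₎`-small sources).  The seat typed the SURVIVING form `Thm8SurvivingAt γ` (`B8Thm8Surviving`: print's
sentence at one γ with `InR`, print's uniqueness clause, and only the refuted members made conditional on `|D^η_{U₀}f|₍₋₃₎ < γ(α₀ + α₁)`).
This file shows the surviving form is NOT an empty repair: it HOLDS, as the abstract `Prop` over `B8SectGH.GFData3`, on the honest
multi-level model family of `B8LeafModelV1` — r05's `B8Thm8MultiLevelTorus.thm8_multiLevelTorus_V1_surviving` (§5 there: ∃!, (1.146),
(1.37), the `|A|`-member with `B₁ + B′₀γ`, the `D^{η*}D^η`-member) and `thm8_multiLevelTorus_V1` (§3 (v) there: all sup members under the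
inspected size with `B₁ + B₈γ₁`; uniqueness among ALL restricted `λ` with (1.146)) PACKAGED in the leaf's quantifier shape.

WHAT THIS FILE PROVES (2 theorems, 0 sorry, no `def`).  §1 `thm8SurvivingAt_v1`: there are ONE size threshold `M₀ > 0` and constants
`B_c ≥ 1`, `B_γ ≥ 1` (on `d, L, b₀, b₁`) such that for every family parameter `M ≥ M₀`, EVERY `γ ≥ 0`, every `B₁ ≥ B_c + B_γ·γ` and every
`B₂`, `Thm8SurvivingAt γ B₁ B₂ (fun i : V1Idx d ℓ hd hL b₀ b₁ M => v1GF i)` — in particular the re-typed leaf conjunct `Thm8SurvivingAt 1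
B₁ B₂` at print's «e.g. γ = 1».  §2 `thm8_hypotheses_satisfiable_v1` — THE HYPOTHESIS CLASS IS EXERCISED (the discharge referee's question
(d), ref-A STATUS 23:00Z: «satisfiability of the hypothesis class (InR ∧ fNorm-small ∧ (1.33)–(1.35)) is what the kernel instance must
show»): on EVERY index `i`, for every `α₀, α₁, γ > 0`, every datum direction `A₀` and EVERY source direction `f₀` of the space `R`
(`Rf₀ = f₀`) there is `t > 0` with `(U₀, U′, f) = (1, tA₀, tf₀)` satisfying ALL hypotheses of the sentence — `InA`, `Reg335`, the processed
(1.34) and (1.35) (strict, finitely many bonds ∕ index bonds), `InR` (linearity of `R`) and `|tf₀|₍₋₂₎ < γ(α₀ + α₁)` (homogeneity bound of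
print's norm from `B8ScaledSupNorm.weight_mul_norm_le_msup` on the finite carrier) — i.e. the admissible set is a cone neighbourhood of `0`
in `(A′, f) ∈ Pert × R`, so the existence clause of §1 is exercised in every direction of the source space, not only at `f = 0` (and by
linearity of the `U₀ = 1` problem that is all of it).  NOT proved here: that the space `R = ΔN(Q′)` of the instance is non-zero (it is
whenever a block of `Λ_k` has two sites; no dimension count is attempted).  The affine dependence `B₁(γ) = B_c + B_γγ` is print's «only some constants change their numerical values» made
explicit, and it is exactly why the `∀γ`-at-fixed-`B₁` typings (`B8.Thm8Printed`, `B8SectGH.Thm8PrintedR`, b08's `B8.Thm8Inspected`) are the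
wrong quantifier shape (`B8SectGH.thm8PrintedR_iff_large`, `B8Thm8Surviving.thm8SurvivingAt_anti`).  Ingredients: print's source size
`fNorm f < γ(α₀ + α₁)` (the family's `|f|₍₋₂₎`, `B8ScaledSupNorm.msup` over the SITES with r03's block map `blkS`) is turned into the pointwise
form r05 consumes by `B8Prop3MultiLevelTorusEta.pointwise_of_msup_le_blk_eta` (the finite V1 carrier makes the p. 86 supremum a genuine
maximum — the `Bdd` side condition of `B8ScaledSupNorm` holds automatically, cf. the referee's consumer note (b) for the N05 leaf); likewise
the inspected size `fGrad 1 f < γ(α₀ + α₁)` over the bonds (`blkV1`); strict `<` by the `+1` in `B_c`.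

HONEST SCOPE ∕ NOT CLAIMED.  (i) MODEL instance exactly as `B8LeafModelV1` (HONEST SCOPE there, (i)–(vi)): `U₀ = 1` only (`Cfg = Unit`),
linear∕abelian chart, (1.34)∕(1.35) in processed form, the Hölder member of (1.36) not part of `C136`; NOT a node discharge; counts unmoved.
(ii) NOT proved here: `¬ B8SectGH.Thm8PrintedAt 1 B₁ B₂ (v1GF ·)` — the typed form presumably fails on this family too (its `C136` carries
the `∇`-member; mechanism `B8HessianSupWitness.scales_lower_bound`), but the Hessian witness is transplanted in the tree to the one-level
carriers `Site P 0` of `B8Thm8TorusWitness`, not to p21's V1 carriers; the refutation of record stays `B8Thm8FlatAbelianFamily`.  (iii) `c₁ := 1`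
nominal (no smallness needed at `U₀ = 1`).  (iv) One finite four-torus programme at fixed ε, Bałaban AS PRINTED with locators; nothing
continuum ∕ ℝ⁴ ∕ OS ∕ mass gap ∕ Clay.
-/

namespace Literature.MathematicalPhysics.QuantumFieldTheory.Balaban1983to89.B8LeafModelV1Thm8

open B6MultiLevelBoxOperator (N0)
open B6MultiLevelTorusOperator (TDomains)
open B6Geom246MultiLevelTorus (geomT)
open B6GlobalChartV1 (PV domT blkV1)
open B8Ineq192MultiLevelTorus (lenT_pos)
open B6SectAOperatorsV1 (dE dsE dcE dcsE QE QpE RE ScalarSpace BondIdx)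
open B6GradLegKLevelV1 (DV)
open BalabanImbrieJaffe1984to88.BIJ85AxialPropagator411 (BondSpace)
open B8ScaledSupNorm (msup msup_nonneg)
open LatticeFieldCalculus (laplace)
open B6ScalarFactorsChartV1 (blkS)
open B8Thm8MultiLevelTorus (thm8_multiLevelTorus_V1 thm8_multiLevelTorus_V1_surviving)
open B8Prop3MultiLevelTorusEta (pointwise_of_msup_le_blk_eta)
open B8LeafModelV1 (V1Idx v1GF)
open B8Thm8Surviving (Thm8SurvivingAt)

noncomputable section

/-- **THEOREM 8 IN ITS SURVIVING FORM HOLDS ON THE `k`-LEVEL V1 TORUS FAMILY AT `U₀ = 1`, FOR EVERY γ ≥ 0** (print p. 101: *"for an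
arbitrary function f from the space R(U₀) satisfying the bound |f|₍₋₂₎ < γ(α₀ + α₁), there exists exactly one gauge transformation u
satisfying (1.29) and such, that the conditions (1.36), (1.37), (1.39), and (1.146) hold … The constants B₁, B₂(β₀) are as in Theorems 2, 4,
the constant c₁ depends on d, L and γ"*; surviving form `B8Thm8Surviving.Thm8SurvivingAt`, GAPS G-B8-13): there are ONE threshold `M₀ > 0` and
`B_c, B_γ ≥ 1` such that for all `M ≥ M₀`, `γ ≥ 0`, `B₁ ≥ B_c + B_γγ`, `B₂`: for every index `i`, every `α₀, α₁ > 0`, every datum `A′` with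
the processed (1.34)∕(1.35) sizes and every source `f` with `Rf = f`, `|f|₍₋₂₎ < γ(α₀ + α₁)` there is a (1.29)-restricted `λ` with (1.146)
`R∂*(A′ − ∂λ) = f`, (1.37), the `|A|`-member `|A′ − ∂λ|₍₋₁₎ < B₁(α₀ + α₁)`, and — if `|∂f|₍₋₃₎ < γ(α₀ + α₁)` — both sup members of (1.36)
and (1.39); unique among restricted `λ′` with (1.146) (a fortiori among print's competitors).  `B_c = max(B₁ⁱ, B₁ˢ) + 1`, `B_γ = B₈ + B′₀`
from r05's `thm8_multiLevelTorus_V1` ∕ `_surviving` at the rate `σ = min(σ₀, σ₁)`, budget `α = 1∕2`.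
[cite: Balaban1985RegularSpaces, Thm 8 + (1.146) p.101, (1.29) p.81, (1.36)–(1.37) p.82, (1.39) p.83, (1.62) p.87; Balaban1984PropagatorsII, (2.7) p.224, (2.12) p.225] -/
theorem thm8SurvivingAt_v1 (d ℓ : ℕ) (hd : 1 ≤ d + 1) (hL : Odd (ℓ + 1) ∧ 1 < ℓ + 1) {b₀ b₁ : ℝ} (hb₀ : 0 < b₀) (hb₁ : b₀ ≤ b₁) :
    ∃ M₀ Bc Bγ : ℝ, 0 < M₀ ∧ 1 ≤ Bc ∧ 1 ≤ Bγ ∧ ∀ M : ℝ, M₀ ≤ M → ∀ γ : ℝ, 0 ≤ γ → ∀ B₁ : ℝ, Bc + Bγ * γ ≤ B₁ → ∀ B₂ : ℝ,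
      Thm8SurvivingAt γ B₁ B₂ (fun i : V1Idx d ℓ hd hL b₀ b₁ M => v1GF i) := by
  obtain ⟨σ₀, hσ₀, h8⟩ := thm8_multiLevelTorus_V1 d ℓ hd hL hb₀ hb₁
  obtain ⟨σ₁, hσ₁, h8s⟩ := thm8_multiLevelTorus_V1_surviving d ℓ hd hL hb₀ hb₁
  obtain ⟨B₁i, B₈, M₈, hB₁i, hB₈, hM₈, hT⟩ :=
    h8 (min σ₀ σ₁) (lt_min hσ₀ hσ₁) (min_le_left _ _) (1 / 2) (by norm_num) (by norm_num)
  obtain ⟨B₁s, B₀', M', hB₁s, hB₀', hM', hS⟩ :=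
    h8s (min σ₀ σ₁) (lt_min hσ₀ hσ₁) (min_le_right _ _) (1 / 2) (by norm_num) (by norm_num)
  refine ⟨max M₈ M', max B₁i B₁s + 1, B₈ + B₀', lt_max_of_lt_left hM₈, ?_, ?_, fun M hM γ hγ B₁ hB₁ B₂ => ?_⟩
  · exact le_trans hB₁i ((le_max_left _ _).trans (le_add_of_nonneg_right zero_le_one))
  · linarith
  refine ⟨1, one_pos, ?_⟩
  intro i α₀ α₁ hα₀ hα₁ _ U₀ A' f _ _ hAx hcl hInR hf
  dsimp only [v1GF] at A' f hAx hcl hInR hf ⊢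
  have hM8t : M₈ ≤ ((ℓ : ℝ) + 1) * i.Mh := (le_max_left _ _).trans (hM.trans i.hM)
  have hM't : M' ≤ ((ℓ : ℝ) + 1) * i.Mh := (le_max_right _ _).trans (hM.trans i.hM)
  have hs : 0 < α₀ + α₁ := add_pos hα₀ hα₁
  have hη : 0 < |i.cf|⁻¹ := inv_pos.2 (abs_pos.2 i.hcf)
  have e2 : (-2 : ℝ) = -((2 : ℕ) : ℝ) := by norm_num
  have e3 : (-3 : ℝ) = -((3 : ℕ) : ℝ) := by norm_num
  -- print's source size `|f|₍₋₂₎ < γ(α₀ + α₁)` in pointwise form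
  rw [e2] at hf
  have hf2 : ∀ x : Site (PV d ℓ i.m i.K hd hL) 0,
      |WithLp.ofLp f x| ≤ γ * (α₀ + α₁) * (((geomT i.D).len (blkS i.hN i.D x) * |i.cf|⁻¹) ^ 2)⁻¹ :=
    pointwise_of_msup_le_blk_eta i.D (blkS i.hN i.D) 2 hη hf.le
  -- Theorem 8 at `U₀ = 1` (r05 §3): uniqueness of the restricted `λ` with (1.146) among ALL such, and the inspected clause (v)
  obtain ⟨⟨n₀, ⟨hn₀, h146₀⟩, huniq₀⟩, hall⟩ := hT i.m i.K i.hN i.D i.hk i.hk1 i.hMha i.hM8 i.hR2 i.hP5 i.hℓ4 hM8t i.hcf i.hw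
    i.hwb A' f hInR α₀ α₁ hα₀.le hα₁.le (fun b => (hAx b).le) (fun c => (hcl c).le)
  -- the surviving part (r05 §5): the restricted `λ` with (1.146); (1.37); the `|A|`-member; the `D*D`-member of (1.39)
  obtain ⟨n, ⟨hn, h146, h37, hA1, -, hJ3⟩, -⟩ := hS i.m i.K i.hN i.D i.hk i.hk1 i.hMha i.hM8 i.hR2 i.hP5 i.hℓ4 hM't i.hcf
    i.hw i.hwb A' f hInR α₀ α₁ γ hα₀.le hα₁.le hγ (fun b => (hAx b).le) (fun c => (hcl c).le) hf2
  have hnn₀ : n = n₀ := huniq₀ n ⟨hn, h146⟩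
  have hB₁s' : (B₁s + B₀' * γ) * (α₀ + α₁) < B₁ * (α₀ + α₁) := by
    have : B₁s + B₀' * γ < B₁ := by
      have h1 : B₁s ≤ max B₁i B₁s := le_max_right _ _
      have h2 : B₀' * γ ≤ (B₈ + B₀') * γ := mul_le_mul_of_nonneg_right (by linarith) hγ
      linarith
    exact mul_lt_mul_of_pos_right this hs
  have hB₁i' : (B₁i + B₈ * γ) * (α₀ + α₁) < B₁ * (α₀ + α₁) := by
    have : B₁i + B₈ * γ < B₁ := by
      have h1 : B₁i ≤ max B₁i B₁s := le_max_left _ _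
      have h2 : B₈ * γ ≤ (B₈ + B₀') * γ := mul_le_mul_of_nonneg_right (by linarith) hγ
      linarith
    exact mul_lt_mul_of_pos_right this hs
  refine ⟨n, hn, ⟨lt_of_le_of_lt hA1 hB₁s', fun c => ?_, h146, fun hg => ?_⟩,
    fun n' hn' _ _ _ h146' => (huniq₀ n' ⟨hn', h146'⟩).trans hnn₀.symm⟩
  · rw [h37]
    exact hcl c
  · -- the inspected size `|∂f|₍₋₃₎ < γ(α₀ + α₁)`: the remaining members (r05 §3 (v))
    rw [e3] at hg
    have hDf : ∀ b : PBond (PV d ℓ i.m i.K hd hL) 0,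
        |WithLp.ofLp (dE i.cf f) b| ≤ γ * (α₀ + α₁) * (((geomT i.D).len (blkV1 i.hN i.D b) * |i.cf|⁻¹) ^ 3)⁻¹ :=
      pointwise_of_msup_le_blk_eta i.D (blkV1 i.hN i.D) 3 hη hg.le
    obtain ⟨-, -, hJ3', -, hins⟩ := hall n hn h146
    obtain ⟨hI1, hI2, hI4, -, -, -⟩ := hins γ hγ hDf
    refine ⟨⟨lt_of_le_of_lt hI1 hB₁i', ?_⟩, fun b => ?_, ?_⟩
    · rw [e2]; exact lt_of_le_of_lt hI2 hB₁i'
    · have hw3 : 0 < (((geomT i.D).len (blkV1 i.hN i.D b) * |i.cf|⁻¹) ^ 3)⁻¹ :=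
        inv_pos.2 (pow_pos (mul_pos (lenT_pos i.D _) hη) 3)
      have hB : B₁i * (α₀ + α₁) < B₁ * (α₀ + α₁) := by
        have : B₁i * (α₀ + α₁) ≤ (B₁i + B₈ * γ) * (α₀ + α₁) :=
          mul_le_mul_of_nonneg_right (le_add_of_nonneg_right (mul_nonneg (zero_le_one.trans hB₈) hγ)) hs.le
        exact lt_of_le_of_lt this hB₁i'
      exact lt_of_le_of_lt (hJ3' b) (mul_lt_mul_of_pos_right hB hw3)
    · rw [e3]; exact lt_of_le_of_lt hI4 hB₁i'

/-! ## §2 The hypothesis class of Theorem 8 on the instance is satisfiable in every direction -/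

/-- **THE HYPOTHESES OF THEOREM 8 ARE SATISFIABLE IN EVERY DIRECTION ON THE INSTANCE** (print p. 101: «for arbitrary U₀, U′U₀ satisfying
(1.33)–(1.35) … and for an arbitrary function f from the space R(U₀) satisfying the bound |f|₍₋₂₎ < γ(α₀ + α₁)»): on every index `i` of the
V1 family, for every `α₀, α₁, γ > 0`, every bond field `A₀` and every `f₀` with `Rf₀ = f₀`, some positive multiple `(tA₀, tf₀)` satisfies
`InA α₀ 1`, `Reg335 α₀ 1`, `InAAx α₀ 1 (tA₀)`, `avgClose α₁ 1 (tA₀)`, `InR 1 (tf₀)` and `fNorm (tf₀) < γ(α₀ + α₁)` — finitely many strict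
size constraints (one per bond, one per index bond, one for the source; `t := 1∕(1 + Σ 1∕r)` lies below every bound `r`), linearity of the
processed data `D^{η*}D^η`, `Q_j`, `R` in `t`, and `|tf₀|₍₋₂₎ ≦ t|f₀|₍₋₂₎` on the finite carrier (`B8ScaledSupNorm.weight_mul_norm_le_msup`,
`B8Prop3MultiLevelTorusEta.bdd_blk_eta`).  Answers the discharge referee's question (d) for the surviving form: its existence clause is
not exercised only at `f = 0`. [cite: Balaban1985RegularSpaces, Thm 8 p.101 + (1.33)–(1.35) p.82 + p.86 (the norm |·|₍₋₂₎) (hypothesis class of the instance; bookkeeping)] -/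
theorem thm8_hypotheses_satisfiable_v1 {d ℓ : ℕ} {hd : 1 ≤ d + 1} {hL : Odd (ℓ + 1) ∧ 1 < ℓ + 1} {b₀ b₁ M : ℝ}
    (i : V1Idx d ℓ hd hL b₀ b₁ M) {α₀ α₁ γ : ℝ} (hα₀ : 0 < α₀) (hα₁ : 0 < α₁) (hγ : 0 < γ)
    (A₀ : BondSpace (PV d ℓ i.m i.K hd hL)) (f₀ : ScalarSpace (PV d ℓ i.m i.K hd hL))
    (hf₀ : RE (domT i.hN i.D i.hk) i.cf f₀ = f₀) :
    ∃ t : ℝ, 0 < t ∧ (v1GF i).InA α₀ () ∧ (v1GF i).Reg335 α₀ () ∧ (v1GF i).InAAx α₀ () (t • A₀) ∧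
      (v1GF i).avgClose α₁ () (t • A₀) ∧ (v1GF i).InR () (t • f₀) ∧ (v1GF i).fNorm (t • f₀) < γ * (α₀ + α₁) := by
  dsimp only [v1GF]
  have hη : 0 < |i.cf|⁻¹ := inv_pos.2 (abs_pos.2 i.hcf)
  have hs : 0 < α₀ + α₁ := add_pos hα₀ hα₁
  -- the finitely many positive size constraints: one per bond (processed (1.34)), one per index bond (processed (1.35)), one for the source
  set J₀ : BondSpace (PV d ℓ i.m i.K hd hL) := dcsE i.cf (dcE i.cf A₀) with hJ₀
  set w₃ : PBond (PV d ℓ i.m i.K hd hL) 0 → ℝ := fun b => (((geomT i.D).len (blkV1 i.hN i.D b) * |i.cf|⁻¹) ^ 3)⁻¹ with hw₃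
  have hw₃pos : ∀ b, 0 < w₃ b := fun b => inv_pos.2 (pow_pos (mul_pos (lenT_pos i.D _) hη) 3)
  set rB : PBond (PV d ℓ i.m i.K hd hL) 0 → ℝ := fun b => 2 * α₀ * w₃ b / (|J₀ b| + 1) with hrB
  have hrBpos : ∀ b, 0 < rB b := fun b => div_pos (mul_pos (mul_pos two_pos hα₀) (hw₃pos b)) (by positivity)
  set wC : BondIdx (domT i.hN i.D i.hk) → ℝ := fun c => (((ℓ : ℝ) + 1) ^ (c.1.1 : ℕ) * |i.cf|⁻¹)⁻¹ with hwC
  have hwCpos : ∀ c, 0 < wC c := fun c => by positivity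
  set rC : BondIdx (domT i.hN i.D i.hk) → ℝ := fun c => 2 * ((d : ℝ) + 1) * ((ℓ : ℝ) + 1) * α₁ * wC c / (|QE (domT i.hN i.D i.hk) A₀ c| + 1)
    with hrC
  have hrCpos : ∀ c, 0 < rC c := fun c => div_pos (mul_pos (by positivity) (hwCpos c)) (by positivity)
  set N₀ : ℝ := msup (ℓ + 1) i.k |i.cf|⁻¹ (-2) (fun j (x : Site (PV d ℓ i.m i.K hd hL) 0) => j ≤ (blkS i.hN i.D x).1.1)
    (WithLp.ofLp f₀) with hN₀
  have hN₀nn : 0 ≤ N₀ := msup_nonneg _ _ hη.le _ _ _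
  set rF : ℝ := γ * (α₀ + α₁) / (N₀ + 1) with hrF
  have hrFpos : 0 < rF := div_pos (mul_pos hγ hs) (by linarith)
  -- one `t` below all of them: `t := 1 / (1 + Σ 1/r)`
  set S : ℝ := 1 + (∑ b, (rB b)⁻¹) + (∑ c, (rC c)⁻¹) + rF⁻¹ with hS
  have hSB : ∀ b, (rB b)⁻¹ ≤ ∑ b', (rB b')⁻¹ := fun b =>
    Finset.single_le_sum (f := fun b' => (rB b')⁻¹) (fun b' _ => (inv_pos.2 (hrBpos b')).le) (Finset.mem_univ b)
  have hSC : ∀ c, (rC c)⁻¹ ≤ ∑ c', (rC c')⁻¹ := fun c =>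
    Finset.single_le_sum (f := fun c' => (rC c')⁻¹) (fun c' _ => (inv_pos.2 (hrCpos c')).le) (Finset.mem_univ c)
  have hsumB : 0 ≤ ∑ b', (rB b')⁻¹ := Finset.sum_nonneg fun b' _ => (inv_pos.2 (hrBpos b')).le
  have hsumC : 0 ≤ ∑ c', (rC c')⁻¹ := Finset.sum_nonneg fun c' _ => (inv_pos.2 (hrCpos c')).le
  have hSpos : 0 < S := by
    have := inv_pos.2 hrFpos
    rw [hS]; linarith
  -- `1/S < r` for every constraint `r` whose reciprocal is one of the summands of `S - 1`
  have key : ∀ r : ℝ, 0 < r → r⁻¹ ≤ S - 1 → S⁻¹ < r := by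
    intro r hr hle
    have h1 : r⁻¹ < S := by linarith
    have := (inv_lt_inv₀ hSpos (inv_pos.2 hr)).2 h1
    rwa [inv_inv] at this
  refine ⟨S⁻¹, inv_pos.2 hSpos, hα₀, hα₀, fun b => ?_, fun c => ?_, ?_, ?_⟩
  · -- (1.34) processed: `|D*D(tA₀)(b)| = t|J₀(b)| < 2α₀ w₃(b)`
    have ht : S⁻¹ < rB b := key (rB b) (hrBpos b) (by rw [hS]; linarith [hSB b, inv_pos.2 hrFpos])
    have hval : |dcsE i.cf (dcE i.cf (S⁻¹ • A₀)) b| = S⁻¹ * |J₀ b| := by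
      rw [map_smul, map_smul, PiLp.smul_apply, smul_eq_mul, abs_mul, abs_of_pos (inv_pos.2 hSpos)]
    rw [hval]
    have h2 : S⁻¹ * (|J₀ b| + 1) < 2 * α₀ * w₃ b := by
      have := (lt_div_iff₀ (by positivity : (0 : ℝ) < |J₀ b| + 1)).1 ht
      exact this
    have h3 : S⁻¹ * |J₀ b| ≤ S⁻¹ * (|J₀ b| + 1) := mul_le_mul_of_nonneg_left (by linarith) (inv_pos.2 hSpos).le
    exact lt_of_le_of_lt h3 h2
  · -- (1.35) processed: `|Q_j(tA₀)(c)| = t|Q_jA₀(c)| < 2dLα₁ (Lʲη)⁻¹`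
    have ht : S⁻¹ < rC c := key (rC c) (hrCpos c) (by rw [hS]; linarith [hSC c, inv_pos.2 hrFpos])
    have hval : |QE (domT i.hN i.D i.hk) (S⁻¹ • A₀) c| = S⁻¹ * |QE (domT i.hN i.D i.hk) A₀ c| := by
      rw [map_smul, PiLp.smul_apply, smul_eq_mul, abs_mul, abs_of_pos (inv_pos.2 hSpos)]
    rw [hval]
    have h2 : S⁻¹ * (|QE (domT i.hN i.D i.hk) A₀ c| + 1) < 2 * ((d : ℝ) + 1) * ((ℓ : ℝ) + 1) * α₁ * wC c :=
      (lt_div_iff₀ (by positivity : (0 : ℝ) < |QE (domT i.hN i.D i.hk) A₀ c| + 1)).1 ht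
    have h3 : S⁻¹ * |QE (domT i.hN i.D i.hk) A₀ c| ≤ S⁻¹ * (|QE (domT i.hN i.D i.hk) A₀ c| + 1) :=
      mul_le_mul_of_nonneg_left (by linarith) (inv_pos.2 hSpos).le
    exact lt_of_le_of_lt h3 h2
  · -- `R(t f₀) = t f₀`
    rw [map_smul, hf₀]
  · -- `|t f₀|₍₋₂₎ ≤ t |f₀|₍₋₂₎ < γ(α₀ + α₁)`
    have ht : S⁻¹ < rF := key rF hrFpos (by rw [hS]; linarith)
    have e2 : (-2 : ℝ) = -((2 : ℕ) : ℝ) := by norm_num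
    have hbdd := B8Prop3MultiLevelTorusEta.bdd_blk_eta i.D (blkS i.hN i.D) 2 hη.le (WithLp.ofLp f₀)
    have hle : msup (ℓ + 1) i.k |i.cf|⁻¹ (-2) (fun j (x : Site (PV d ℓ i.m i.K hd hL) 0) => j ≤ (blkS i.hN i.D x).1.1)
        (WithLp.ofLp (S⁻¹ • f₀)) ≤ S⁻¹ * N₀ := by
      refine B8ScaledSupNorm.msup_le (mul_nonneg (inv_pos.2 hSpos).le hN₀nn) fun j hj x hx => ?_
      have h1 : B8ScaledSupNorm.weight (ℓ + 1) |i.cf|⁻¹ (-2) j * ‖WithLp.ofLp f₀ x‖ ≤ N₀ := by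
        rw [hN₀, e2]
        exact B8ScaledSupNorm.weight_mul_norm_le_msup hbdd hj hx
      have h2 : ‖WithLp.ofLp (S⁻¹ • f₀) x‖ = S⁻¹ * ‖WithLp.ofLp f₀ x‖ := by
        rw [WithLp.ofLp_smul, Pi.smul_apply, norm_smul, Real.norm_eq_abs, abs_of_pos (inv_pos.2 hSpos)]
      rw [h2]
      have hw : 0 ≤ B8ScaledSupNorm.weight (ℓ + 1) |i.cf|⁻¹ (-2) j := B8ScaledSupNorm.weight_nonneg _ hη.le _ _
      calc B8ScaledSupNorm.weight (ℓ + 1) |i.cf|⁻¹ (-2) j * (S⁻¹ * ‖WithLp.ofLp f₀ x‖)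
          = S⁻¹ * (B8ScaledSupNorm.weight (ℓ + 1) |i.cf|⁻¹ (-2) j * ‖WithLp.ofLp f₀ x‖) := by ring
        _ ≤ S⁻¹ * N₀ := mul_le_mul_of_nonneg_left h1 (inv_pos.2 hSpos).le
    have h2 : S⁻¹ * (N₀ + 1) < γ * (α₀ + α₁) := (lt_div_iff₀ (by linarith : (0 : ℝ) < N₀ + 1)).1 ht
    have h3 : S⁻¹ * N₀ ≤ S⁻¹ * (N₀ + 1) := mul_le_mul_of_nonneg_left (by linarith) (inv_pos.2 hSpos).le
    exact lt_of_le_of_lt (hle.trans h3) h2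

/-! ## §3 The space `R` of the instance is non-zero on every index -/

open B6SectAOperatorsV1 (mem_ker_QpE_iff RE_fix ofLp_lapE lapE) in
open B6SectAZeroModesV1 (laplace_injOn_gaugeSpace) in
open B6GlobalChartV1 (domT_Om_one) in
open LatticeFieldCalculus (siteAvg siteAvgIter siteAvg_eq_blockSum) in
open B5AveragingLocalityV1 (siteAvg_zero) in
/-- **THE SPACE `R(U₀)` OF THE INSTANCE IS NON-ZERO ON EVERY INDEX** (v2; removes the caveat «NOT proved here: that the space R = ΔN(Q′) of the
instance is non-zero» of the module docstring and completes the answer to the discharge referee's question (d)): for every `i : V1Idx …` there is a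
source `f₀ ≠ 0` of the space `R` («a function f from the space R(U₀), i.e. … satisfying R(U₀)f = f», p. 101; [B6] p. 225 «R [is] an orthogonal
projection … onto the subspace ΔN(Q′)»).  Witness: two distinct fine sites `x₀ ≠ x₁` of ONE `1`-block (`L ≥ 5`), the gauge function
`λ = δ_{x₀} − δ_{x₁}` has vanishing block averages at every level `j ≥ 1` (`siteAvg λ = 0`, then `siteAvgIter (j+1) λ = siteAvg (siteAvgIter j λ) = 0`), and
`Λ₀ = ∅` for the V1 domain datum (`B6GlobalChartV1.domT_Om_one`), so `λ ∈ N(Q′)` ([B6] (2.7)); `λ ≠ 0`; `f₀ := Δλ = ∂*∂λ` is fixed by `R` (`RE_fix`) and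
non-zero because `Δ` is injective on `N(Q′)` (p21's `B6SectAZeroModesV1.laplace_injOn_gaugeSpace`).  With `thm8_hypotheses_satisfiable_v1` (every direction
`(A₀, f₀ ∈ R)` is admissible after scaling) the existence clause of `thm8SurvivingAt_v1` is exercised at a non-zero source on every index.
[cite: Balaban1985RegularSpaces, (1.146) p.101, (1.29) p.81; Balaban1984PropagatorsII, (2.7) p.224, (2.12) p.225] -/
theorem exists_source_ne_zero_v1 {d ℓ : ℕ} {hd : 1 ≤ d + 1} {hL : Odd (ℓ + 1) ∧ 1 < ℓ + 1} {b₀ b₁ M : ℝ}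
    (i : V1Idx d ℓ hd hL b₀ b₁ M) :
    ∃ f₀ : ScalarSpace (PV d ℓ i.m i.K hd hL), RE (domT i.hN i.D i.hk) i.cf f₀ = f₀ ∧ f₀ ≠ 0 := by
  classical
  -- two distinct fine sites in one `1`-block
  have hj : 0 + 1 ≤ (PV d ℓ i.m i.K hd hL).m + (PV d ℓ i.m i.K hd hL).K := by
    show 0 + 1 ≤ i.m + i.K
    have := i.hk; have := i.hk1; omega
  have hL2 : 1 < (PV d ℓ i.m i.K hd hL).L := by show 1 < ℓ + 1; have := i.hℓ4; omega
  set y : Site (PV d ℓ i.m i.K hd hL) 1 := fun _ => 0 with hy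
  set r₀ : Fin (PV d ℓ i.m i.K hd hL).d → Fin (PV d ℓ i.m i.K hd hL).L := fun _ => ⟨0, by omega⟩ with hr₀
  set r₁ : Fin (PV d ℓ i.m i.K hd hL).d → Fin (PV d ℓ i.m i.K hd hL).L := fun _ => ⟨1, hL2⟩ with hr₁
  set x₀ := Site.blockSite y r₀ with hx₀
  set x₁ := Site.blockSite y r₁ with hx₁
  have hne : x₀ ≠ x₁ := by
    intro h
    have h0 := Site.val_blockSite hj y r₀ (0 : Fin (d + 1))
    have h1 := Site.val_blockSite hj y r₁ (0 : Fin (d + 1))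
    rw [← hx₀] at h0
    rw [← hx₁, ← h] at h1
    rw [h0] at h1
    simp [hr₀, hr₁] at h1
  have hb₀ : blockOf x₀ = y := Site.blockOf_blockSite hj y r₀
  have hb₁ : blockOf x₁ = y := Site.blockOf_blockSite hj y r₁
  -- the gauge function `λ = δ_{x₀} − δ_{x₁}`: zero block means at every level `≥ 1`
  set lam : SiteField (PV d ℓ i.m i.K hd hL) 0 ℝ := fun x => (if x = x₀ then (1 : ℝ) else 0) - (if x = x₁ then 1 else 0) with hlam
  have hlam0 : lam x₀ = 1 := by simp [hlam, hne]
  have havg : siteAvg lam = 0 := by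
    funext y'
    rw [siteAvg_eq_blockSum hj lam y', Pi.zero_apply]
    have hsum : ∑ x ∈ block y', lam x = 0 := by
      simp only [hlam, Finset.sum_sub_distrib, Finset.sum_ite_eq', block, Finset.mem_filter, Finset.mem_univ, true_and, hb₀, hb₁]
      split_ifs <;> simp
    rw [hsum, smul_zero]
  have hiter : ∀ j, 1 ≤ j → siteAvgIter j lam = 0 := by
    intro j hj1
    induction j with
    | zero => omega
    | succ n ih =>
      rcases Nat.eq_zero_or_pos n with h0 | hpos
      · subst h0
        show siteAvg (siteAvgIter 0 lam) = 0
        exact havg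
      · show siteAvg (siteAvgIter n lam) = 0
        rw [ih hpos]
        exact siteAvg_zero
  have hgauge : (domT i.hN i.D i.hk).InGauge lam := by
    intro j z hz
    rcases Nat.eq_zero_or_pos j with h0 | hpos
    · subst h0
      exfalso
      rw [B6SectADomainsV1.Domains.lamSite_zero_iff] at hz
      apply hz
      change blockOf z ∈ (domT i.hN i.D i.hk).Om 1
      rw [domT_Om_one i.hN i.D i.hk i.hk1]
      exact Finset.mem_univ _
    · rw [hiter j hpos]; rfl
  -- `n := λ` as an `L²` vector: restricted, non-zero; `f₀ := Δn ∈ ΔN(Q′)` is fixed by `R` and non-zero (Δ injective on N(Q′))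
  set n : ScalarSpace (PV d ℓ i.m i.K hd hL) := WithLp.toLp 2 lam with hn
  have hnker : n ∈ LinearMap.ker (QpE (domT i.hN i.D i.hk)) := (mem_ker_QpE_iff _ n).2 hgauge
  refine ⟨B6SectAOperatorsV1.lapE i.cf n, ?_, ?_⟩
  · exact RE_fix (domT i.hN i.D i.hk) i.cf n hnker
  · intro h0
    have hinj := laplace_injOn_gaugeSpace (domT i.hN i.D i.hk) i.hcf
    have h1 : laplace i.cf (WithLp.ofLp n) = laplace i.cf (WithLp.ofLp (0 : ScalarSpace (PV d ℓ i.m i.K hd hL))) := by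
      rw [← ofLp_lapE, ← ofLp_lapE, h0, map_zero]
    have h2 := hinj ((B6SectADomainsV1.Domains.mem_gaugeSpace_iff _ _).2 hgauge)
      (Submodule.zero_mem _) (by simpa using h1)
    have : lam x₀ = 0 := by
      have := congrArg (fun g => g x₀) h2
      simpa [hn] using this
    rw [hlam0] at this
    exact one_ne_zero this

end

end Literature.MathematicalPhysics.QuantumFieldTheory.Balaban1983to89.B8LeafModelV1Thm8
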